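import Summits.AtomisticToContinuum.Crystallization.Theorems.ExcessDecayLiouvilleHcpLiouvilleOfInputs

/-!
# `ExcessDecayLiouville.HcpLiouville` (stmt-AtomisticToContinuum-9332), line `Sketch` (skeleton v5.2): stub `stub_core_of_caccioppoli`

The coarse Liouville statement over the mirror predicates (the right-hand side of `BlowdownLine.hcpLiouville_iff`)
from (i) the relaxed inner shift of every admissible cell and (ii) interface (C) of the blow-down,
`∃ C, Blowdown.CaccioppoliProp (1/20) C`, taken as a hypothesis.  This is the landed composition
`BlowdownLine.core_of_inputs` (`…HcpLiouvilleOfInputs.lean`) with its only use of ray-secant coercivity — the line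
`obtain ⟨C_C, hC⟩ := stub_caccioppoli (1 / 20) κ₁ hκ₁ hSC` — replaced by the hypothesis; every other step
(`stub_onePerSite`, `BlowdownLine.anchor_of_inputs`, `stub_remainder`, `stub_green`, `stub_interior`,
`stub_improvement`, `Blowdown.psIneq_of_forall`, `stub_iteration`, `BlowdownLine.card_ball_le`,
`BlowdownLine.exists_site_near`, `LevelOne.norm_vField_le`, `finite_sites_dist_le`, `BlowdownLine.sites_of_constant`)
is verbatim.

All `[folklore]`; a `--supports` helper for item stmt-AtomisticToContinuum-9332, nothing here closes an item.
-/

noncomputable section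

namespace Summit.AtomisticToContinuum.Crystallization.Theorems.ExcessDecayLiouville

open scoped BigOperators Topology Classical InnerProductSpace
open Literature.MathematicalPhysics.StatisticalMechanics
open Summit.AtomisticToContinuum.Crystallization.Theses.ExcessDecayLiouville
open Summit.AtomisticToContinuum.Crystallization.Theorems.PhononStabilityNegative

local notation "E3" => EuclideanSpace ℝ (Fin 3)

/-- **The coarse Liouville statement from the Caccioppoli interface**: given the relaxed inner shift of every
admissible cell and a constant `C` with `Blowdown.CaccioppoliProp (1/20) C`, phonon stability implies that every
uniformly discrete equilibrium configuration which is `1/40`-close at every scale to an admissible hcp-like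
two-lattice is itself an admissible two-lattice (same cell `A`, anchored and translated datum). [folklore] -/
theorem stub_core_of_caccioppoli :
    (∀ (A : E3 →L[ℝ] E3), Adm₀ A →
      ∃ e : E3, ‖e - A (barlowOffset 1 + layerNormal (Real.sqrt (2 / 3)))‖ ≤ 1 / 40 ∧
        HasSum (fun z : Λ₀ => (deriv lennardJones ‖e + A z‖ / ‖e + A z‖) • (e + A z)) 0) →
    (∃ C : ℝ, Blowdown.CaccioppoliProp (1 / 20) C) →
    PhononStability → ∀ δ : ℝ, 0 < δ → ∀ X : Set E3, Sep₀ X δ → Equil₀ X →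
      ∀ (t : Fin 2 → E3) (A : E3 →L[ℝ] E3), Adm₀ A → Inner₀ t A →
        (∀ (c : E3) (r : ℝ), Near₀ X c r t A (1 / 40)) →
          ∃ (t' : Fin 2 → E3) (A' : E3 →L[ℝ] E3), Adm₀ A' ∧ X = Sites₀ t' A' := by
  intro hRS hCacc hPS δ hδ X hSep hEq t A hA hI hN
  obtain ⟨κ, hκ, hPSκ⟩ := phononStability_iff.1 hPS
  obtain ⟨u, hu⟩ := stub_onePerSite δ hδ X hSep hEq t A hA hI hN
  obtain ⟨τ, hτ, hIτ, hEτ⟩ := BlowdownLine.anchor_of_inputs hRS t A hA hI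
  obtain ⟨C_C, hC⟩ := hCacc
  obtain ⟨C_R, hR⟩ := stub_remainder
  obtain ⟨C_F, hF⟩ := stub_green κ hκ
  obtain ⟨C_D, hD⟩ := stub_interior κ hκ
  obtain ⟨θ, R₀, K, hθ, hθ1, hR₀, hImp⟩ := stub_improvement (1 / 20) κ C_C C_R C_F C_D hκ hC hR hF hD
  have hPSτ : Blowdown.PSIneq κ (anchorDatum t τ) A := Blowdown.psIneq_of_forall hPSκ hA hIτ
  have hIP := hImp X t A u τ hA hI hPSτ hEq hu hτ hIτ hEτ
  obtain ⟨m, hm⟩ := stub_iteration (Sites₀ (anchorDatum t τ) A) (LevelOne.vField t A τ u) θ R₀ K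
    (fun c r => finite_sites_dist_le hA hIτ c r) (fun c r hr F hF => BlowdownLine.card_ball_le hA hIτ c hr F hF)
    (fun c => BlowdownLine.exists_site_near hA (anchorDatum t τ) c)
    (fun s hs => LevelOne.norm_vField_le hA hI hIτ hu hs) hθ hθ1 hR₀ hIP
  exact ⟨fun i => anchorDatum t τ i + m, A, hA, BlowdownLine.sites_of_constant hA hI hIτ hu hm⟩

end Summit.AtomisticToContinuum.Crystallization.Theorems.ExcessDecayLiouville

end
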